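import Summits.QuantumFields.BalabanUV.T4Continuum.Support.NE7CoarseCurlFrameLetter
import Summits.QuantumFields.BalabanUV.T4Continuum.Support.NE3LinearisedAverageSup
import HarnessLib

/-!
# NE7SupLiftFloor — THE SUP-NORM ROUTE TO (G′), HESSIAN HALF: for a fibre element whose fine field obeys the Bałaban-scaled SUP bound `‖X̃(b)‖ ≤ σ·L^{−(j+1)}` (e.g. the minimising lift, once
# the linearised minimiser is known to be ℓ^∞-bounded with the natural scaling — ROAD-G118 §5 (S3)), the two letters of F7∕G9 are IMMEDIATE and j-UNIFORM — scaled mass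
# `q·dirSq X̃ ≤ 4·N⁴·σ²`, accumulated frames `Σ_{z∈periodBox N}‖framePotW X̃ z‖² ≤ N⁴·(24σ)²` (row NE3's ✓ `norm_framePotW_le_sup`) — hence the HESSIAN FLOOR
# `Σ_P nhs(curl_{V₀}ṽ) ≤ (1+θ′)·((1+θ)·hess U X̃ X̃ + K·4N⁴σ²) + (1+θ′⁻¹)·16·#pl·ε²·576·N⁴σ²` with NO slice, NO gauge fixing, NO lift letters (d = 4; lineage `b2b-balaban-t4-ne7-p1`, gen 118, file G15)

Cell `pub-balaban`, rung (B)+1 sub-cell t4, CRUX PROVER NE7 #1 (OWNER of row NE7), generation 118.  WHY (memo ROAD-G118 §5 (S3)).  `D²m(0)[v,v] = w·hess(X̃_min) − Dm(0)[D²𝒢(0)[X_min,X_min]]` at the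
minimising lift; if `‖X̃_min(b)‖ ≤ C·L^{−(j+1)}·|v|_∞` (a k-UNIFORM ℓ^∞ bound on the linearised minimiser — Bałaban's `H_k`∕`G_k` regularity, rows NE2∕NE3's propagator tower; NOT in the tree: the
tree's Lipschitz constant of `V ↦ U_k(V)` is existential, ✓ `NE7MinimiserLipschitzChart`), then with `σ = C|v|_∞` everything below is `O(N⁴|v|²_∞)`, and so are the multiplier's level masses
(✓ `NE3LinearisedAverageSup.norm_dirIter_le_sup`: `‖dirIter_i X̃‖ ≤ (3+12d)L^i·σL^{−(j+1)}`), whence `D²m ≥ w(1 − Cε)Σ_P nhs(curl_{V₀}ṽ) − w·Cε·N⁴|v|²_∞` j-uniformly (N fixed in the UV limit).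
THIS FILE is the Hessian half of that route ([folklore]; 0 def, 0 sorry): §1 (general d) `dirSq_le_of_sup`, `dirSq_periodBox_le_of_sup`, `sum_normSq_le_of_sup`; §2 (d = 4) `curvSum_line_of_curv`
(the curvature line of row NE3's sup letters from `LevelSmall` and the k-free line `curv 4 L ε ≤ 1∕4`), **`scaledMass_le_of_sup`**, **`frameMass_le_of_sup`**, **`coarse_curl_le_hess_of_sup`**.
HONEST FRAMING: kinematics over landed kernel theorems about OUR objects; the sup bound is a displayed HYPOTHESIS on the fibre element (for the minimising lift it is an open k-uniform estimate);
the multiplier term is not bounded here; nothing of Bałaban's asserted ([Balaban1985Variational] Thm 1 (9)–(10), [Balaban1985PropagatorsII] context); NOT (G′), NOT NE7 as a spine node; spine 0∕9;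
finite T⁴ rung (B)+1 — NOT infinite volume, NOT mass gap, NOT BetaPertH, NOT Clay.
-/

set_option autoImplicit false

open scoped BigOperators Matrix Matrix.Norms.L2Operator
open NormedSpace Finset

namespace Summit.QuantumFields.BalabanUV.T4Continuum.NE7SupLiftFloor

open Literature.MathematicalPhysics.QuantumFieldTheory.Balaban1983to89
open B7Prop1Explicit B7Prop2Explicit MatrixLog UnitaryModel
open T4AveragingDeficitWall (IsUnitaryCfg IsSkewDir SmallField Ad curl curlAt curlSq dirSq)
open T4AveragingDeficitWallBoundary (IsPeriodicCfg periodBox card_periodBox)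
open AveragingDeficitPeriodicCounting (IsPeriodicDir)
open AveragingDeficitTorusChart (TDir chartDir isPeriodicDir_chartDir)
open AveragingDeficitTwoLevelPrep (twoLevelSmall skewSub)
open AveragingDeficitMultiLevelPrep (cavgIter tower levelQ' tower_ne_zero LevelSmall)
open MatrixNorms (nhsNormSq nhsNormSq_nonneg)
open MinimalActionLevels (perWin)
open NE3HessForm (hess)
open NE3TangentCovariantTower (framePotW)
open NE3EnergyHessContTwoTerm (dirSq_nonneg)
open NE7RadIterUniform (radD levelSmall_of_class_radius)
open NE7StraightTowerCurlEnergy (eC mC eC_nonneg)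
open NE7FlatAverageCurlCommutation (isSkewDir_chartDir_id)
open NE3LinearisedAverageSup (curv curvSum curv_mono curv_mul curv_nonneg curvSum_le_of_levelSmall norm_framePotW_le_sup)
open NE3EnergyRateWSupOfSlicePoincare (tower_eq_mul_pow)
open NE7CoarseCurlFrameLetter (coarse_curl_le_of_frameLetter)

noncomputable section

variable {d : ℕ} {n : Type*} [Fintype n] [DecidableEq n]

/-! ## §1 Sums from sup bounds (general `d`) -/

/-- `dirSq Y F ≤ #F·d·s²` under `‖Y x κ‖ ≤ s`. [folklore] -/
theorem dirSq_le_of_sup (Y : Site d → Fin d → Matrix n n ℂ) (F : Finset (Site d)) {s : ℝ} (hY : ∀ (x : Site d) (κ : Fin d), ‖Y x κ‖ ≤ s) :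
    dirSq Y F ≤ (F.card : ℝ) * d * s ^ 2 := by
  unfold dirSq
  calc ∑ x ∈ F, ∑ κ : Fin d, ‖Y x κ‖ ^ 2 ≤ ∑ _x ∈ F, ∑ _κ : Fin d, s ^ 2 :=
        Finset.sum_le_sum fun x _ => Finset.sum_le_sum fun κ _ => pow_le_pow_left₀ (norm_nonneg _) (hY x κ) 2
    _ = (F.card : ℝ) * d * s ^ 2 := by
        rw [Finset.sum_const, Finset.sum_const, Finset.card_univ, Fintype.card_fin, nsmul_eq_mul, nsmul_eq_mul]; ring

/-- `dirSq Y (periodBox P) ≤ P^d·d·s²` under `‖Y x κ‖ ≤ s`. [folklore] -/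
theorem dirSq_periodBox_le_of_sup (Y : Site d → Fin d → Matrix n n ℂ) (P : ℕ) {s : ℝ} (hY : ∀ (x : Site d) (κ : Fin d), ‖Y x κ‖ ≤ s) :
    dirSq Y (periodBox (d := d) P) ≤ ((P : ℝ) ^ d) * d * s ^ 2 := by
  have h := dirSq_le_of_sup Y (periodBox (d := d) P) hY
  rw [card_periodBox] at h
  push_cast at h
  exact h

/-- `Σ_{z∈periodBox P} ‖G z‖² ≤ P^d·g²` under `‖G z‖ ≤ g`. [folklore] -/
theorem sum_normSq_le_of_sup (G : Site d → Matrix n n ℂ) (P : ℕ) {g : ℝ} (hG : ∀ z : Site d, ‖G z‖ ≤ g) :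
    ∑ z ∈ periodBox (d := d) P, ‖G z‖ ^ 2 ≤ ((P : ℝ) ^ d) * g ^ 2 := by
  calc ∑ z ∈ periodBox (d := d) P, ‖G z‖ ^ 2 ≤ ∑ _z ∈ periodBox (d := d) P, g ^ 2 :=
        Finset.sum_le_sum fun z _ => pow_le_pow_left₀ (norm_nonneg _) (hG z) 2
    _ = ((P : ℝ) ^ d) * g ^ 2 := by rw [Finset.sum_const, card_periodBox, nsmul_eq_mul]; push_cast; ring

/-! ## §2 The letters and the floor for a sup-bounded fine field (`d = 4`) -/

omit [Fintype n] [DecidableEq n] in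
/-- **THE CURVATURE LINE FROM THE CLASS**: `LevelSmall 4 L j (ε·(L²)⁻¹^{j+1})`, `L ≥ 2`, `0 ≤ ε` and the k-free line `curv 4 L ε ≤ 1∕4` give `curvSum 4 L (j+1) (ε·(L²)⁻¹^{j+1}) ≤ (2∕3)·L`. [folklore] -/
theorem curvSum_line_of_curv {L : ℕ} (hL : 2 ≤ L) (j : ℕ) {ε : ℝ} (hε : 0 ≤ ε) (hs : LevelSmall 4 L j (ε * (((L : ℝ) ^ 2)⁻¹) ^ (j + 1)))
    (hcurv : curv 4 L ε ≤ 1 / 4) : curvSum 4 L (j + 1) (ε * (((L : ℝ) ^ 2)⁻¹) ^ (j + 1)) ≤ 2 / 3 * L := by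
  have hL0 : (0 : ℝ) < L := by exact_mod_cast (show 0 < L by omega)
  have hL1r : (1 : ℝ) ≤ L := by exact_mod_cast (show 1 ≤ L by omega)
  have hx : 0 ≤ ε * (((L : ℝ) ^ 2)⁻¹) ^ (j + 1) := by positivity
  have h := curvSum_le_of_levelSmall (d := 4) hL j hx hs
  have e : ((L : ℝ) ^ 2) ^ j * (ε * (((L : ℝ) ^ 2)⁻¹) ^ (j + 1)) = ((L : ℝ) ^ 2)⁻¹ * ε := by
    rw [pow_succ, inv_pow]
    field_simp
    ring
  rw [e, curv_mul] at h
  have hq1 : ((L : ℝ) ^ 2)⁻¹ ≤ 1 := inv_le_one_of_one_le₀ (by nlinarith)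
  have hq0 : 0 ≤ ((L : ℝ) ^ 2)⁻¹ := by positivity
  have hc0 : 0 ≤ curv 4 L ε := curv_nonneg (d := 4) L hε
  have h1 : ((L : ℝ) ^ 2)⁻¹ * curv 4 L ε ≤ 1 / 4 := by nlinarith
  nlinarith

/-- **SCALED MASS FROM THE SUP BOUND** (`d = 4`): `‖X̃(b)‖ ≤ σ·(L⁻¹)^{j+1}` ⟹ `(L⁻¹)^{2(j+1)}·dirSq X̃ (periodBox (tower L N (j+1))) ≤ 4·N⁴·σ²`. [folklore] -/
theorem scaledMass_le_of_sup {L N : ℕ} (hL : 1 ≤ L) (j : ℕ) {Y : Site 4 → Fin 4 → Matrix n n ℂ} {σ : ℝ}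
    (hY : ∀ (x : Site 4) (κ : Fin 4), ‖Y x κ‖ ≤ σ * ((L : ℝ)⁻¹) ^ (j + 1)) :
    ((L : ℝ)⁻¹) ^ (2 * (j + 1)) * dirSq Y (periodBox (tower L N (j + 1))) ≤ 4 * (N : ℝ) ^ 4 * σ ^ 2 := by
  have hL0 : (0 : ℝ) < L := by exact_mod_cast (show 0 < L by omega)
  have h := dirSq_periodBox_le_of_sup Y (tower L N (j + 1)) hY
  rw [tower_eq_mul_pow] at h ⊢
  push_cast at h ⊢
  have hq : 0 ≤ ((L : ℝ)⁻¹) ^ (2 * (j + 1)) := by positivity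
  calc ((L : ℝ)⁻¹) ^ (2 * (j + 1)) * dirSq Y (periodBox (N * L ^ (j + 1)))
      ≤ ((L : ℝ)⁻¹) ^ (2 * (j + 1)) * (((N : ℝ) * (L : ℝ) ^ (j + 1)) ^ 4 * 4 * (σ * ((L : ℝ)⁻¹) ^ (j + 1)) ^ 2) := mul_le_mul_of_nonneg_left h hq
    _ = 4 * (N : ℝ) ^ 4 * σ ^ 2 * (((L : ℝ)⁻¹ * L) ^ (j + 1)) ^ 4 := by ring
    _ = 4 * (N : ℝ) ^ 4 * σ ^ 2 := by rw [inv_mul_cancel₀ hL0.ne', one_pow, one_pow, mul_one]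

/-- **ACCUMULATED FRAMES FROM THE SUP BOUND** (`d = 4`, tower class at `U` with `LevelSmall`, curvature line): `‖X̃(b)‖ ≤ σ·(L⁻¹)^{j+1}` ⟹
`Σ_{z∈periodBox N} ‖framePotW L (j+1) U X̃ z‖² ≤ N⁴·(24σ)²`. [folklore] -/
theorem frameMass_le_of_sup [Nonempty n] {L N : ℕ} (hL : 2 ≤ L) (j : ℕ) {U : Site 4 → Fin 4 → (Matrix n n ℂ)ˣ} {x : ℝ} (hU : IsUnitaryCfg U) (hx : 0 ≤ x)
    (hs : LevelSmall 4 L j x) (hUx : SmallField U x) (hA : curvSum 4 L (j + 1) x ≤ 2 / 3 * L)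
    {Y : Site 4 → Fin 4 → Matrix n n ℂ} {σ : ℝ} (hσ : 0 ≤ σ) (hY : ∀ (z : Site 4) (κ : Fin 4), ‖Y z κ‖ ≤ σ * ((L : ℝ)⁻¹) ^ (j + 1)) :
    ∑ z ∈ periodBox (d := 4) N, ‖framePotW L (j + 1) U Y z‖ ^ 2 ≤ (N : ℝ) ^ 4 * (24 * σ) ^ 2 := by
  have hL0 : (0 : ℝ) < L := by exact_mod_cast (show 0 < L by omega)
  have hs0 : 0 ≤ σ * ((L : ℝ)⁻¹) ^ (j + 1) := by positivity
  have hG : ∀ z : Site 4, ‖framePotW L (j + 1) U Y z‖ ≤ 24 * σ := by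
    intro z
    have h := norm_framePotW_le_sup (d := 4) hL j hU hx hs hUx hs0 hY hA z
    refine h.trans (le_of_eq ?_)
    have e : (L : ℝ) ^ (j + 1) * (σ * ((L : ℝ)⁻¹) ^ (j + 1)) = σ * (((L : ℝ) * (L : ℝ)⁻¹) ^ (j + 1)) := by ring
    rw [show (6 : ℝ) * ((4 : ℕ) : ℝ) * (L : ℝ) ^ (j + 1) * (σ * ((L : ℝ)⁻¹) ^ (j + 1)) = 24 * ((L : ℝ) ^ (j + 1) * (σ * ((L : ℝ)⁻¹) ^ (j + 1))) from by push_cast; ring,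
      e, mul_inv_cancel₀ hL0.ne', one_pow, mul_one]
  exact sum_normSq_le_of_sup _ N hG

/-- **THE HESSIAN FLOOR FOR A SUP-BOUNDED FIBRE ELEMENT** (`d = 4`, every `U(n)`, `L ≥ 2`, j-UNIFORM): class configuration `U` (radius `ε·L^{−2(j+1)}`, period `tower L N (j+1)`), the k-free
lines `hεD`, `hεT`, `hεM` of F7 and `curv 4 L ε ≤ 1∕4`; a skew fine torus field `X` with `‖X̃(b)‖ ≤ σ·(L⁻¹)^{j+1}`; then for every `θ, θ′ > 0`, `K := (1+θ)·14·#pl·ε + (1+θ⁻¹)·36eC²ε²`: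
`Σ_{P∈perWin N} nhsNormSq (curl V₀ ṽ P) ≤ (1+θ′)·((1+θ)·hess U X̃ X̃ (perWin 4 (tower L N (j+1))) + K·(4N⁴σ²)) + (1+θ′⁻¹)·(16·#pl·ε²·(N⁴(24σ)²))`. [cite: Balaban1985Averaging, (48) p.25, (120) p.35] -/
theorem coarse_curl_le_hess_of_sup [Nonempty n] {L N : ℕ} [NeZero L] [NeZero N] (hL : 2 ≤ L) (hN : 1 ≤ N) {ε : ℝ} (hε : 0 ≤ ε)
    (hεD : 4 * ε * radD 4 L * (((L : ℝ) ^ 2)⁻¹) ^ 2 ≤ 1) (hεT : twoLevelSmall 4 L * (2 * ε * ((L : ℝ) ^ 2)⁻¹) ≤ 1)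
    (hεM : 8 * (L : ℝ) * mC 4 L (Fintype.card n) * ε * ((L : ℝ) ^ 2)⁻¹ ≤ 1) (hcurv : curv 4 L ε ≤ 1 / 4) (j : ℕ)
    {U : Site 4 → Fin 4 → (Matrix n n ℂ)ˣ} (hU : IsUnitaryCfg U) (hUP : IsPeriodicCfg U ((tower L N (j + 1) : ℕ) : ℤ))
    (hUx : SmallField U (ε * (((L : ℝ) ^ 2)⁻¹) ^ (j + 1)))
    {X : TDir 4 n (L * tower L N j)} (hX : X ∈ skewSub 4 n (L * tower L N j)) {σ : ℝ} (hσ : 0 ≤ σ)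
    (hXs : ∀ (y : Site 4) (κ : Fin 4), ‖chartDir (ContinuousLinearMap.id ℝ (Matrix n n ℂ)) (L * tower L N j) X y κ‖ ≤ σ * ((L : ℝ)⁻¹) ^ (j + 1))
    {θ θ' : ℝ} (hθ : 0 < θ) (hθ' : 0 < θ') :
    ∑ P ∈ perWin 4 N, nhsNormSq
        (curl (cavgIter L (j + 1) U) (chartDir (ContinuousLinearMap.id ℝ (Matrix n n ℂ)) N ((levelQ' L N j U X : ↥(skewSub 4 n N)) : TDir 4 n N)) P)
      ≤ (1 + θ') * ((1 + θ) * hess U (chartDir (ContinuousLinearMap.id ℝ (Matrix n n ℂ)) (L * tower L N j) X) (chartDir (ContinuousLinearMap.id ℝ (Matrix n n ℂ)) (L * tower L N j) X)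
              (perWin 4 (tower L N (j + 1)))
          + ((1 + θ) * (14 * (Fintype.card (T4AveragingDeficitWall.Plane 4) : ℝ) * ε) + (1 + θ⁻¹) * (36 * eC 4 L (Fintype.card n) ^ 2 * ε ^ 2)) * (4 * (N : ℝ) ^ 4 * σ ^ 2))
        + (1 + θ'⁻¹) * (16 * (Fintype.card (T4AveragingDeficitWall.Plane 4) : ℝ) * ε ^ 2 * ((N : ℝ) ^ 4 * (24 * σ) ^ 2)) := by
  have hL1 : 1 ≤ L := by omega
  obtain ⟨hs, -⟩ := levelSmall_of_class_radius (d := 4) hL hε hεD hεT j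
  have hx : 0 ≤ ε * (((L : ℝ) ^ 2)⁻¹) ^ (j + 1) := by positivity
  have hA := curvSum_line_of_curv hL j hε hs hcurv
  set Xt := chartDir (ContinuousLinearMap.id ℝ (Matrix n n ℂ)) (L * tower L N j) X with hXt
  have hΦ := frameMass_le_of_sup (N := N) hL j hU hx hs hUx hA hσ hXs
  have h := coarse_curl_le_of_frameLetter hL hN hε hεD hεT hεM j hU hUP hUx hX hΦ hθ hθ'
  have hm := scaledMass_le_of_sup (N := N) hL1 j hXs
  -- monotonicity in the scaled mass
  have hK0 : 0 ≤ (1 + θ) * (14 * (Fintype.card (T4AveragingDeficitWall.Plane 4) : ℝ) * ε) + (1 + θ⁻¹) * (36 * eC 4 L (Fintype.card n) ^ 2 * ε ^ 2) := by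
    have := eC_nonneg 4 L (ν := (Fintype.card n : ℝ)); positivity
  have hθ'1 : 0 ≤ 1 + θ' := by linarith
  have h1 := mul_le_mul_of_nonneg_left hm hK0
  have h2 := mul_le_mul_of_nonneg_left (add_le_add (le_refl ((1 + θ) * hess U Xt Xt (perWin 4 (tower L N (j + 1))))) h1) hθ'1
  refine h.trans ?_
  have e : ((1 + θ) * (14 * (Fintype.card (T4AveragingDeficitWall.Plane 4) : ℝ) * ε) + (1 + θ⁻¹) * (36 * eC 4 L (Fintype.card n) ^ 2 * ε ^ 2))
        * ((L : ℝ)⁻¹) ^ (2 * (j + 1)) * dirSq Xt (periodBox (tower L N (j + 1)))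
      = ((1 + θ) * (14 * (Fintype.card (T4AveragingDeficitWall.Plane 4) : ℝ) * ε) + (1 + θ⁻¹) * (36 * eC 4 L (Fintype.card n) ^ 2 * ε ^ 2))
        * (((L : ℝ)⁻¹) ^ (2 * (j + 1)) * dirSq Xt (periodBox (tower L N (j + 1)))) := by ring
  rw [e]
  linarith

end

end Summit.QuantumFields.BalabanUV.T4Continuum.NE7SupLiftFloor
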